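import Summits.CriticalPhenomena.PercolationContinuityZ3.Theorems.Transplant.FKConnectivityAllQAntipodalDefs
import HarnessLib

/-!
# Connectivity correlation inequalities for `φ_{w,q}`, every `q > 0` — file 23 (DEFINITION): the antipodal up-correlation
# functional with a GENERAL LEVEL WEIGHT (the object behind "Theorem U holds coefficientwise in `q`")

Definitions file (`--supports stmt-CriticalPhenomena-4575`), FK sub-lane `prim-bschramm-fk-2` (gen 18) of the post-continuity
programme; builds on p205010 (kernel theorem, internal audit signed; external expert review pending).  No named facts, no sorries,
nothing probabilistic.

`…AntipodalDefs.lean` (gen 11) attached to an edge set `E` with terminals `s, t` the antipodal up-correlation functional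
`apUpc q E s t h = ∑_{γ ⊆ E} q^{k(γ)+k(E\γ)} (1{s↔t in γ} - 1{s↔t in E\γ}) h(γ)`, and `…AntipodalUpc.lean` proved it nonnegative on
two-terminal series–parallel networks for every real `q > 0` (Theorem U).  As a function of `q` it is a polynomial whose coefficient
of `q^ℓ` collects the complementary pairs `(γ, E\γ)` at CLUSTER LEVEL `k(γ)+k(E\γ) = ℓ`.  This file replaces the geometric weight
`q^ℓ` by an arbitrary weight sequence `w : ℕ → ℝ`:
* `FK.apUpcLW w E s t h = ∑_{γ ⊆ E} w(k(γ)+k(E\γ)) (1{s↔t in γ} - 1{s↔t in E\γ}) h(γ)`; `apUpc q = apUpcLW (q^·)` (`FK.apUpc_eq_apUpcLW`).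
The sibling `…AntipodalWeightUpc.lean` proves `0 ≤ apUpcLW w M s t h` for every sub-network `M` of a two-terminal series–parallel
network, every `w ≥ 0` and every monotone `h` — i.e. Theorem U LEVEL BY LEVEL (`w = 1_{·=ℓ}`: every coefficient of the polynomial is
nonnegative; `w = 1_{·≤J}`: Abel partial sums), the combinatorial form used by the word-Hall reductions of gens 12–16 (FK-Q2 §21–25,
there on paper) and by the level form of Conjecture AND⁺ (gen 17–18, FK-Q2 §26–27).
[cite: Grimmett2006, §1.4 eq. (1.20) (p. 15); §3.8 (pp. 61–62)] [cite: Wagner2006, Thm. 5.8(d), §5.3]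
-/

noncomputable section

namespace Summit.CriticalPhenomena.PercolationContinuityZ3.Theorems

namespace FK

open Literature.Probability.LatticeModels Literature.Probability.Percolation
open scoped Classical

variable {V : Type*}

/-- **Antipodal up-correlation functional with a general level weight**:
`apUpcLW w E s t h = ∑_{γ ⊆ E} w(k(γ)+k(E\γ)) · (1{s ↔ t in γ} - 1{s ↔ t in E \ γ}) · h(γ)`; for `w = (q ^ ·)` this is `apUpc q E s t h`,
for `w = 1_{· = ℓ}` the coefficient of `q^ℓ` in `apUpc · E s t h`.
[cite: Grimmett2006, §1.4 eq. (1.20) (p. 15); §3.8 (pp. 61–62)] -/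
def apUpcLW (w : ℕ → ℝ) (E : Finset (Sym2 V)) (s t : V) (h : Finset (Sym2 V) → ℝ) : ℝ :=
  ∑ γ ∈ E.powerset, w (apExp E γ) * ((apConn γ s t - apConn (E \ γ) s t) * h γ)

/-- `apUpc q` is `apUpcLW` with the geometric weight `n ↦ q^n`. [folklore] -/
theorem apUpc_eq_apUpcLW (q : ℝ) (E : Finset (Sym2 V)) (s t : V) (h : Finset (Sym2 V) → ℝ) :
    apUpc q E s t h = apUpcLW (fun n => q ^ n) E s t h := rfl

/-- The weighted functional of the empty network vanishes. [folklore] -/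
theorem apUpcLW_empty (w : ℕ → ℝ) (s t : V) (h : Finset (Sym2 V) → ℝ) : apUpcLW w ∅ s t h = 0 := by
  unfold apUpcLW
  rw [Finset.powerset_empty, Finset.sum_singleton, sdiff_self, Finset.bot_eq_empty, sub_self, zero_mul, mul_zero]

end FK

end Summit.CriticalPhenomena.PercolationContinuityZ3.Theorems

end
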